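import Literature.AlgebraicGeometry.Motives.JacobianThetaDivisorOfCurveIso
import Literature.AlgebraicGeometry.Morphisms.GeometricPointsLiftSurjective
import Literature.AlgebraicGeometry.RelativeSpec.SymmetricPowerGlued
import HarnessLib

/-!
# The rational points of the Brill–Noether loci `W̃_r(P)`, and the support of a theta divisor along `C`

Layer `Literature/AlgebraicGeometry/Motives`, namespaces `….Morphisms` (§1) and `….Motives.Jacobian` (§2–§4).  KERNEL ONLY
(theorems; no definition, no named fact, no instance, no `sorry`).  Sequel of ★ `Motives/JacobianThetaDivisor` (`abelSum`,
`brillNoetherLocus`, `IsRiemannThetaDivisor`) and ★ `Motives/JacobianThetaDivisorOfCurveIso` (`comp_prod`).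

## The mathematics ([Milne1986JacobianVarieties] §5 and §6 Lemma 6.7, [Lange2023AbelianVarietiesComplex] §4.2.1, §4.4.2 Lemma 4.4.4 Step I)

Let `C` be a PROPER curve over an algebraically closed field `k`, `𝒥` a Jacobian, `P ∈ C(k)`, `f = f^P : C → J` the
Abel–Jacobi map, `α_{rP} : C^r → J`, `(x₁,…,x_r) ↦ Σ f(xᵢ)` the Abel sum map and `W̃_r(P) = \overline{α_{rP}(C^r)}` (★
`brillNoetherLocus`, a CLOSURE by definition).  Since `C^r` is proper and `J` separated, `α_{rP}` is a closed map and
(§2) **`W̃_r(P) = α_{rP}(C^r)`**; since `k` is algebraically closed, `k`-points of `J` lying on `W̃_r(P)` come from `k`-points of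
`C^r` (§1, the Nullstellensatz on the fibre), so (§3) **`x ∈ W̃_r(P)(k) ⟺ x = Σ_{i<r} f(τᵢ)` for some `τ : Fin r → C(k)`**
(Milne §5: «`W^r` is the image of `C^{(r)}`»).  Consequently (§4, the SUPPORT half of Milne's Lemma 6.7 / Lange's Lemma 4.4.4
Step I, free of `Pic⁰(C)` and of Weil's construction): if `Θ` is a divisor on `J` with support `W̃_r(P)` and `a = Σ_{j ≤ r} f(τⱼ)`
is a sum of `r + 1` points whose summand-tuple is UNIQUE up to permutation (`|D(a)| = {D(a)}`), then for `Q ∈ C(k)`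

  **`a − f(Q) ∈ supp Θ ⟺ Q ∈ {τ₀, …, τ_r}`** —

«`Q₁ ∈ f⁻¹(Θ⁻_a)` iff `f(Q₁) + Σ_{i ≥ 2} f(Qᵢ) = a` for some `Q₂, …`, which forces `Σ Qᵢ = D(a)`» (Milne p. 187).  The remaining
(load-bearing) half of Step I — multiplicity ONE, i.e. `(C · Θ) = g` — is not touched here.

## What is proved
§1 `Morphisms.exists_comp_eq_of_mem_range`, `Morphisms.exists_over_comp_eq_of_mem_range` (geometric points over a point of the
IMAGE of a morphism locally of finite type lift — the pointwise form of ★ `exists_over_comp_eq_of_surjective`); §2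
`Jacobian.comp_abelSum_eq_prod`, `Jacobian.isClosed_range_abelSum`, **`Jacobian.brillNoetherLocus_eq_range`**; §3
**`Jacobian.pt_mem_brillNoetherLocus_iff`**; §4 **`Jacobian.pt_mul_inv_mem_brillNoetherLocus_iff_of_unique`**,
**`Jacobian.pt_mul_inv_mem_compl_nonvanishing_iff_of_unique`** (letters (L-W), (L-b) of the cell `hodgecm-mathlib`, road G4 leaf
(g4-3a), census A-p02 (g15) `CENSUS-g43` §5, pen A-p04 (g17) ruling #1 (R3)).  COUNT-NEUTRAL.  HC_CM is proved only modulo the 7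
printed citations until rung 0 closes; this file moves no book by itself.

## References
* [Milne1986JacobianVarieties] J. S. Milne, *Jacobian Varieties* (1986), §5 (the maps `f^r`, `W^r`), §6 Lemma 6.7 (p. 187).
* [Lange2023AbelianVarietiesComplex] H. Lange, *Abelian Varieties over the Complex Numbers* (2023), §4.2.1 (`W̃_n = α_{nc}(C^{(n)})`),
  §4.4.2 Lemma 4.4.4 (Step I).
* [GortzWedhorn2020] U. Görtz, T. Wedhorn, *Algebraic Geometry I*, 2nd ed. (2020), Cor. 3.36 (p. 83), Prop. 4.8 (p. 98) (points
  with values in algebraically closed fields), Prop. 12.58 (proper ⇒ closed).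
-/

set_option autoImplicit false

noncomputable section

open CategoryTheory CategoryTheory.Limits AlgebraicGeometry

universe u

namespace Literature.AlgebraicGeometry.Morphisms

/-! ## §1 Geometric points over a point of the image lift -/

/-- **Geometric points over the IMAGE lift**: for `f : X → Y` locally of finite type, `Ω` algebraically closed and
`y : Spec Ω → Y` whose underlying point lies in `f(X)`, there is `x : Spec Ω → X` with `x ≫ f = y` (a closed point of the
non-empty Jacobson scheme `X ×_Y Spec Ω`, read as an `Ω`-point by the Nullstellensatz; the pointwise form of ★
`exists_comp_eq_of_surjective`). [cite: GortzWedhorn2020, Cor. 3.36 (p. 83) and Prop. 4.8 (p. 98)] -/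
theorem exists_comp_eq_of_mem_range {X Y : Scheme.{u}} (f : X ⟶ Y) [LocallyOfFiniteType f]
    {Ω : Type u} [Field Ω] [IsAlgClosed Ω] (y : Spec (.of Ω) ⟶ Y)
    (hy : y (IsLocalRing.closedPoint Ω) ∈ Set.range f) :
    ∃ x : Spec (.of Ω) ⟶ X, x ≫ f = y := by
  let g : pullback f y ⟶ Spec (.of Ω) := pullback.snd f y
  haveI : JacobsonSpace ↑(pullback f y) := LocallyOfFiniteType.jacobsonSpace g
  -- the fibre product is non-empty: a point of `X` over the image point
  obtain ⟨x₀, hx₀⟩ := hy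
  obtain ⟨z, -, -⟩ := Scheme.Pullback.exists_preimage_pullback (f := f) (g := y) x₀ (IsLocalRing.closedPoint Ω) hx₀
  -- a closed point of the Jacobson scheme `X ×_Y Spec Ω`
  obtain ⟨a, -, hac⟩ := nonempty_inter_closedPoints (Z := (Set.univ : Set ↑(pullback f y))) ⟨z, trivial⟩
    isClosed_univ.isLocallyClosed
  refine ⟨pointOfClosedPoint g a (mem_closedPoints_iff.mp hac) ≫ pullback.fst f y, ?_⟩
  rw [Category.assoc, pullback.condition, ← Category.assoc, pointOfClosedPoint_comp, Category.id_comp]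

/-- **The same over a base**: for an `S`-morphism `u : X → Y` locally of finite type on underlying schemes and a point
`y : Spec Ω → Y` over `s : Spec Ω → S` (`Ω` algebraically closed) whose underlying point lies in `u(X)`, there is a point
`x : Spec Ω → X` over `s` with `x ≫ u = y`. [cite: GortzWedhorn2020, Cor. 3.36 (p. 83) and Prop. 4.8 (p. 98)] -/
theorem exists_over_comp_eq_of_mem_range {S : Scheme.{u}} {X Y : Over S} (u : X ⟶ Y) [LocallyOfFiniteType u.left]
    {Ω : Type u} [Field Ω] [IsAlgClosed Ω] (s : Spec (.of Ω) ⟶ S) (y : Over.mk s ⟶ Y)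
    (hy : y.left (IsLocalRing.closedPoint Ω) ∈ Set.range u.left) :
    ∃ x : Over.mk s ⟶ X, x ≫ u = y := by
  obtain ⟨x₀, hx₀⟩ := exists_comp_eq_of_mem_range u.left y.left hy
  have hx : x₀ ≫ X.hom = s := by
    rw [← Over.w u, ← Category.assoc, hx₀]
    exact Over.w y
  exact ⟨Over.homMk x₀ hx, Over.OverMorphism.ext hx₀⟩

end Literature.AlgebraicGeometry.Morphisms

namespace Literature.AlgebraicGeometry.Motives

namespace Jacobian

open RelativeSpec Literature.AlgebraicGeometry.Morphisms
open scoped MonObj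

variable {k : Type u} [Field k] {C : SchemeOver k} (𝒥 : Jacobian C)

/-! ## §2 `W̃_r(P) = α_{rP}(C^r)` for a proper curve -/

/-- A `T`-valued point of `C^r` followed by the Abel sum map is the product of the Abel–Jacobi images of its coordinates:
`z ≫ α_{rP} = ∏ᵢ (z ≫ prᵢ) ≫ f^P` (★ `comp_prod`). [cite: Milne1986JacobianVarieties, §5 (the maps f^r : C^r → J)] -/
theorem comp_abelSum_eq_prod {T : SchemeOver k} (P : AlgPoints C k) (r : ℕ) (z : T ⟶ powOverObj C.hom r) :
    z ≫ 𝒥.abelSum P r = ∏ i : Fin r, (z ≫ (projOver C.hom r i : powOverObj C.hom r ⟶ C)) ≫ 𝒥.abelJacobi P := by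
  unfold abelSum
  rw [comp_prod]
  exact Finset.prod_congr rfl fun i _ => (Category.assoc _ _ _).symm

/-- The tuple point `(τ₀, …, τ_{r−1})` of `C^r` followed by the Abel sum map is `∏ᵢ f^P(τᵢ)`.
[cite: Milne1986JacobianVarieties, §5 (the maps f^r : C^r → J)] -/
theorem liftOver_comp_abelSum {T : SchemeOver k} (P : AlgPoints C k) (r : ℕ) (τ : Fin r → (T ⟶ C)) :
    liftOver C.hom r τ ≫ 𝒥.abelSum P r = ∏ i : Fin r, τ i ≫ 𝒥.abelJacobi P := by
  rw [comp_abelSum_eq_prod]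
  exact Finset.prod_congr rfl fun i _ => congrArg (· ≫ 𝒥.abelJacobi P) (liftOver_projOver C.hom r τ i)

/-- **The Abel sum map of a proper curve has closed image**: `C^r` is proper over `k` (★ `isProper_powOver_base`) and `J` is
separated, so `α_{rP} : C^r → J` is proper, in particular closed. [cite: GortzWedhorn2020, Prop. 12.58 (p. 349)] [cite: Milne1986JacobianVarieties, §5 (W^r is a closed subvariety)] -/
theorem isClosed_range_abelSum [IsProper C.hom] (P : AlgPoints C k) (r : ℕ) :
    IsClosed (Set.range (𝒥.abelSum P r).left) := by
  haveI : IsProper (powOverObj C.hom r).hom := isProper_powOver_base C.hom r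
  haveI : IsProper 𝒥.J.X.hom := 𝒥.J.isProper
  have h : IsProper ((𝒥.abelSum P r).left ≫ 𝒥.J.X.hom) := by
    rw [Over.w (𝒥.abelSum P r)]
    infer_instance
  haveI : IsProper (𝒥.abelSum P r).left := IsProper.of_comp (𝒥.abelSum P r).left 𝒥.J.X.hom
  exact (𝒥.abelSum P r).left.isClosedMap.isClosed_range

/-- **`W̃_r(P) = α_{rP}(C^r)`** for a proper curve: the Brill–Noether locus (the closure of the image of the Abel sum map,
★ `brillNoetherLocus`) is the image itself (Milne §5: «`W^r` is the image of `C^{(r)}`»; Lange §4.2.1 `W̃_n = α_{nc}(C^{(n)})`).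
[cite: Milne1986JacobianVarieties, §5 (W^r is a closed subvariety)] [cite: Lange2023AbelianVarietiesComplex, §4.2.1 (W̃_n = α_{nc}(C^{(n)}))] -/
theorem brillNoetherLocus_eq_range [IsProper C.hom] (P : AlgPoints C k) (r : ℕ) :
    𝒥.brillNoetherLocus P r = Set.range (𝒥.abelSum P r).left :=
  (𝒥.isClosed_range_abelSum P r).closure_eq

/-! ## §3 The `k`-points of `W̃_r(P)` (`k` algebraically closed) -/

/-- **`x ∈ W̃_r(P)(k) ⟺ x = Σ_{i<r} f^P(τᵢ)` for some `τ : Fin r → C(k)`** (`k` algebraically closed, `C` proper and locally of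
finite type): (⇐) the tuple point of `C^r` maps to `x`; (⇒) `x` lies in the image of the proper map `α_{rP}` (§2), so the
`k`-point `x` lifts to a `k`-point of `C^r` (§1), whose coordinates are the `τᵢ`.  Milne §5: «`W^r` = image of `C^{(r)}`,
`D ↦ f^{(r)}(D)`». [cite: Milne1986JacobianVarieties, §5 (the maps f^r : C^r → J)] [cite: GortzWedhorn2020, Cor. 3.36 (p. 83) and Prop. 4.8 (p. 98)] -/
theorem pt_mem_brillNoetherLocus_iff [IsAlgClosed k] [IsProper C.hom] (P : AlgPoints C k) (r : ℕ) (x : 𝒥.J.Points k) :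
    x.pt ∈ 𝒥.brillNoetherLocus P r ↔ ∃ τ : Fin r → AlgPoints C k, (∏ i : Fin r, τ i ≫ 𝒥.abelJacobi P) = x := by
  rw [brillNoetherLocus_eq_range]
  constructor
  · intro hx
    -- `α_{rP}` is locally of finite type (`C^r` and `J` are, over `k`)
    haveI : LocallyOfFiniteType (powOverObj C.hom r).hom :=
      locallyOfFiniteType_powOver_base C.hom r
    haveI : LocallyOfFiniteType ((𝒥.abelSum P r).left ≫ 𝒥.J.X.hom) := by
      rw [Over.w (𝒥.abelSum P r)]; infer_instance
    haveI : LocallyOfFiniteType (𝒥.abelSum P r).left :=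
      locallyOfFiniteType_of_comp (𝒥.abelSum P r).left 𝒥.J.X.hom
    obtain ⟨z, hz⟩ := exists_over_comp_eq_of_mem_range (𝒥.abelSum P r)
      (Spec.map (CommRingCat.ofHom (algebraMap k k))) x hx
    refine ⟨fun i => z ≫ (projOver C.hom r i : powOverObj C.hom r ⟶ C), ?_⟩
    show (∏ i : Fin r, (z ≫ (projOver C.hom r i : powOverObj C.hom r ⟶ C)) ≫ 𝒥.abelJacobi P) = x
    rw [← comp_abelSum_eq_prod, hz]
  · rintro ⟨τ, rfl⟩
    rw [← liftOver_comp_abelSum]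
    exact ⟨(liftOver C.hom r τ).left (IsLocalRing.closedPoint k), rfl⟩

/-! ## §4 The support of a divisor with support `W̃_r(P)` along the curve (Milne Lemma 6.7, support half) -/

/-- **`a · f(Q)⁻¹ ∈ W̃_r(P) ⟺ Q ∈ {τ₀, …, τ_r}`** when `a = ∏_{j ≤ r} f(τⱼ)` is a product of `r + 1` Abel–Jacobi images whose
tuple is UNIQUE up to permutation (`huniq`; for a Jacobian: `h⁰(D(a)) = 1`): (⇒) `a · f(Q)⁻¹ = ∏_{i<r} f(ρᵢ)` (§3) gives
`a = ∏ f((Q ∷ ρ)ⱼ)`, so `Q ∷ ρ` is a permutation of `τ` and `Q = τ_{σ 0}`; (⇐) for `Q = τⱼ` take `ρ = τ ∘ j.succAbove`.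
This is the set-theoretic content of Milne's Lemma 6.7 («`Q₁ ∈ f⁻¹(Θ⁻_a)` iff `f(Q₁) + Σ_{i≥2} f(Qᵢ) = a`, which forces
`Σ Qᵢ = D(a)`») / Lange's Lemma 4.4.4 Step I, stated WITHOUT `Pic⁰(C)`: uniqueness of the tuple is the hypothesis.
[cite: Milne1986JacobianVarieties, §6 Lemma 6.7 (p. 187)] [cite: Lange2023AbelianVarietiesComplex, §4.4.2 Lemma 4.4.4 (Step I)] -/
theorem pt_mul_inv_mem_brillNoetherLocus_iff_of_unique [IsAlgClosed k] [IsProper C.hom] (P : AlgPoints C k) {r : ℕ}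
    (τ : Fin (r + 1) → AlgPoints C k) (a : 𝒥.J.Points k) (hτ : (∏ j : Fin (r + 1), τ j ≫ 𝒥.abelJacobi P) = a)
    (huniq : ∀ τ' : Fin (r + 1) → AlgPoints C k, (∏ j : Fin (r + 1), τ' j ≫ 𝒥.abelJacobi P) = a →
      ∃ σ : Equiv.Perm (Fin (r + 1)), τ' = τ ∘ σ)
    (Q : AlgPoints C k) :
    (a * (Q ≫ 𝒥.abelJacobi P)⁻¹).pt ∈ 𝒥.brillNoetherLocus P r ↔ Q ∈ Set.range τ := by
  rw [pt_mem_brillNoetherLocus_iff]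
  constructor
  · rintro ⟨ρ, hρ⟩
    -- `a = f(Q) · ∏ f(ρᵢ) = ∏ f((Q ∷ ρ)ⱼ)`
    have hcons : (∏ j : Fin (r + 1), (Fin.cons Q ρ : Fin (r + 1) → AlgPoints C k) j ≫ 𝒥.abelJacobi P) = a := by
      rw [Fin.prod_univ_succ, Fin.cons_zero]
      simp only [Fin.cons_succ]
      rw [hρ, mul_comm a, ← mul_assoc, mul_inv_cancel, one_mul]
    obtain ⟨σ, hσ⟩ := huniq _ hcons
    refine ⟨σ 0, ?_⟩
    have h0 := congrFun hσ 0
    rw [Fin.cons_zero] at h0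
    exact h0.symm
  · rintro ⟨j, rfl⟩
    refine ⟨fun i => τ (j.succAbove i), ?_⟩
    -- `∏_{i ≠ j} f(τᵢ) = a · f(τⱼ)⁻¹`
    rw [← hτ, Fin.prod_univ_succAbove (fun j' => τ j' ≫ 𝒥.abelJacobi P) j, mul_comm (τ j ≫ 𝒥.abelJacobi P),
      mul_inv_cancel_right]

/-- **Support of a theta divisor along the curve (Milne Lemma 6.7, support half; letter (L-b)).**  If `Θ` is a Cartier divisor
on `J` whose support `J ∖ J_1` is `W̃_r(P)` (e.g. a Riemann theta divisor with `r = g − 1`, up to the translation absorbed in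
`a`), and `a = ∏_{j ≤ r} f(τⱼ)` with the tuple `τ` unique up to permutation, then the points `Q ∈ C(k)` with `a · f(Q)⁻¹ ∈ supp Θ`
— i.e. `f(Q) ∈ t_a((−1)·supp Θ) = supp Θ⁻_a` — are exactly `τ₀, …, τ_r`. [cite: Milne1986JacobianVarieties, §6 Lemma 6.7 (p. 187)]
[cite: Lange2023AbelianVarietiesComplex, §4.4.2 Lemma 4.4.4 (Step I)] -/
theorem pt_mul_inv_mem_compl_nonvanishing_iff_of_unique [IsAlgClosed k] [IsProper C.hom] (P : AlgPoints C k) {r : ℕ}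
    (τ : Fin (r + 1) → AlgPoints C k) (a : 𝒥.J.Points k) (hτ : (∏ j : Fin (r + 1), τ j ≫ 𝒥.abelJacobi P) = a)
    (huniq : ∀ τ' : Fin (r + 1) → AlgPoints C k, (∏ j : Fin (r + 1), τ' j ≫ 𝒥.abelJacobi P) = a →
      ∃ σ : Equiv.Perm (Fin (r + 1)), τ' = τ ∘ σ)
    {Θ : CartierDivisor 𝒥.J.X.left} (hΘ : (Θ.nonvanishing 1)ᶜ = 𝒥.brillNoetherLocus P r) (Q : AlgPoints C k) :
    (a * (Q ≫ 𝒥.abelJacobi P)⁻¹).pt ∈ (Θ.nonvanishing 1)ᶜ ↔ Q ∈ Set.range τ := by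
  rw [hΘ]
  exact 𝒥.pt_mul_inv_mem_brillNoetherLocus_iff_of_unique P τ a hτ huniq Q

end Jacobian

end Literature.AlgebraicGeometry.Motives

end
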